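import Literature.NumberTheory.Sieve.LiouvillePolynomialValuesDensity
import HarnessLib

/-!
# Teräväinen's Corollary 2.1 ⇐ the 99% Elliott bound for the Liouville function (Theorem 2.6, `g_j = λ`)

Topic `NumberTheory/Sieve`. Fact-decomposition file (librarian, mode `fact-decompose`, 2026-08-16)
for the named fact `Literature.NumberTheory.Sieve.teravainen2024_cor_2_1`
(`LiouvillePolynomialValues.lean`; J. Teräväinen, *On the Liouville function at polynomial
arguments*, Amer. J. Math. 146 (2024) 1115–1167 = arXiv:2010.07924, Corollary 2.1: each sign of
`λ(P(n))` has positive lower density for non-square `P` splitting over `ℚ`).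

In print Corollary 2.1 "follows as a special case" of **Theorem 2.6** (the 99% Elliott
theorem), §2.1 and the last Remark after Theorem 2.6.  The tree has PROVED that deduction in
full (`LiouvillePolynomialValuesProofs.lean`: the structure lemma
`exists_linearForms_of_isNonSquarePoly`; `LiouvillePolynomialValuesDensity.lean`:
`teravainen2024_cor_2_1_of_thm_2_6_liouville`), the cases `k ≤ 2` of Theorem 2.6 for `λ`
unconditionally (Tao's two-point logarithmic Elliott theorem; hence Corollary 2.1 for
`deg P ≤ 2`, `teravainen2024_cor_2_1_of_natDegree_le_two`), and — towards Theorem 2.6 itself —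
**Proposition 5.4 for `λ`** (`Teravainen2024.liouville_prop54_core`, files `…P54*.lean`,
`…ProgressionMR.lean`: minor arcs by Weyl differencing, major arcs by Matomäki–Radziwiłł).

What remains unproved of the fact is therefore exactly Theorem 2.6 for `g₁ = ⋯ = g_k = λ`
(`q = 2`), which this file NAMES (`Teravainen2024_elliott99_liouville`, the hypothesis of
`teravainen2024_cor_2_1_of_thm_2_6_liouville` verbatim) together with the PROVED assembly
`teravainen2024_cor_2_1_holds_of`.  Inside Theorem 2.6 the remaining printed steps are §5.1
(reduction to logarithmic windows — proved in the tree in the form `norm_sum_le_of_logWindow_le`),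
§5.2 (Tao's entropy decrement argument in `k`-point form), §5.3 (the Green–Tao dense model
theorem and generalized von Neumann theorem with the `W`-tricked majorant, and the 99% inverse
theorem along progressions, Prop. 5.3) and §5.5 (conclusion from Props. 5.3–5.4).  The child is
a correlation bound for `λ` along `k` linear forms — not a restatement of the parent (a density
statement about `λ ∘ P`).

## References
* J. Teräväinen, Amer. J. Math. 146 (2024) 1115–1167; arXiv:2010.07924: Corollary 2.1,
  Theorem 2.6 and the Remarks after it, §5 (Props. 5.3, 5.4, §5.5). [Teravainen2024]
* T. Tao, Forum Math. Pi 4 (2016), e8: Theorem 1.3. [TaoFMP2016]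
-/

namespace Literature.NumberTheory.Sieve

open Finset

/-- **Teräväinen 2024, Theorem 2.6 (the "99% Elliott" theorem) for the Liouville function.**
Printed (Thm. 2.6): for `k ≥ 1`, `a₁,…,a_k, h₁,…,h_k` with `aᵢhⱼ ≠ aⱼhᵢ` (`i ≠ j`) and
`1`-bounded multiplicative `g₁,…,g_k` with `g₁` taking values in the `q`-th roots of unity and
non-pretentious (`𝔻(g₁, χ; ∞) = ∞`), one has
`limsup_{x→∞} |(1/x) ∑_{n≤x} g₁(a₁n+h₁)⋯g_k(a_kn+h_k)| ≤ 1 − δ` for some `δ = δ(k, q, a, h) > 0`.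
Vendored in the case `g_j = λ` for all `j` (`q = 2`; the non-pretentiousness of `λ` is Tao 2016
(1.6), in the tree `LFunctions.Tao2016_liouvilleNonpretentious_holds`), with shifts and moduli
`aᵢ, bᵢ ≥ 1`, pairwise non-proportional forms, and the `limsup` rendered `ε`-free: there are
`δ > 0` and `x₀` with `|∑_{n≤x} ∏ᵢ λ(aᵢn + bᵢ)| ≤ (1 − δ)x` for all `x ≥ x₀`.  This is the
hypothesis of the tree's `teravainen2024_cor_2_1_of_thm_2_6_liouville` verbatim; the cases
`k ≤ 2` are proved there (`liouville_correlationBound_of_le_two`), and Proposition 5.4 for `λ`,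
the Matomäki–Radziwiłł input of the printed proof, is proved in `…P54Core.lean`; the entropy
decrement / dense model / inverse theorem steps of §5 are not in the tree.
[cite: Teravainen2024, Theorem 2.6 (case g_j = λ, q = 2) and §5] -/
def Teravainen2024_elliott99_liouville : Prop :=
  ∀ (k : ℕ) (a b : Fin k → ℕ), 1 ≤ k → (∀ i, 1 ≤ a i) → (∀ i, 1 ≤ b i) →
    (∀ i j, i ≠ j → a i * b j ≠ a j * b i) →
    ∃ δ : ℝ, 0 < δ ∧ ∃ x₀ : ℕ, ∀ x : ℕ, x₀ ≤ x →
      |∑ n ∈ Icc 1 x, ∏ i, (ArithmeticFunction.liouville (a i * n + b i) : ℝ)| ≤ (1 - δ) * x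

/-- **Assembly (fact split): Corollary 2.1 from Theorem 2.6 for `λ`** — the printed derivation
"Corollary 2.1 follows as a special case" (§2.1), proved in the tree as
`teravainen2024_cor_2_1_of_thm_2_6_liouville`. [cite: Teravainen2024, §2.1 and Theorem 2.6] -/
theorem teravainen2024_cor_2_1_holds_of (h : Teravainen2024_elliott99_liouville) :
    teravainen2024_cor_2_1 :=
  teravainen2024_cor_2_1_of_thm_2_6_liouville h

end Literature.NumberTheory.Sieve
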